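import Summits.QuantumFields.YangMills.Theorems.BalabanLadderNTBoundaryLawLargeDepth
import Summits.QuantumFields.YangMills.Theorems.BalabanLadderNTBoundaryLawSymmetry
import HarnessLib

/-!
# Crux `NT` (stmt-QuantumFields-19353), stub `stub_cfp : CFP`: the CORE form of the boundary laws an engine must deliver

Helper file (`--supports stmt-QuantumFields-19353`) of the fleet lead prover of crux `NT` (unit `ym-spine-19353-p1`);
packages the three unconditional reductions of the femto boundary laws — large depth (`…LargeDepth`), one
orientation (`…Symmetry`) and, new here, cubes based at the ORIGIN (translation covariance of the cube kernels, tree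
`ymSpecification_map_configShift`, Georgii 2011 (5.8)) — into the single statements an engine has to prove:

* `fbl_of_core D`  — `FBL G r a` (the conjunct of the registered `CFP`) follows from: for `β ≥ β₁` and every femto
  cube `[0, b)⁴` BASED AT THE ORIGIN (`b · a β ≤ ℓ₁`), every exterior `η` and every site `y` of depth `≥ D`,
  `|kerE (dens y) − p β| ≤ C₁ / depth⁴` (any `D`, any `p`, any sign of `C₁`);
* `fbl6_of_core D` — `FBL6 G r a` follows from the same statement for the ONE single-plane field of orientation
  `(0, 1)`.

* translations: `configShift_configShift`, `sitePlus_mem_cubeSites`, `cubeEdges_map_edgeShift`, `depth_add`,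
  `dens_configShift`, `plane_configShift`, `kerE_configShift`, `kerE_dens_configShift`, `kerE_plane_configShift`;
* pointwise transports `boundaryLaw_dens_of_origin`, `boundaryLaw_plane01_of_origin`; the cores.
-/

set_option autoImplicit false

noncomputable section

open MeasureTheory Filter Topology
open Literature.MathematicalPhysics.QuantumFieldTheory Literature.MathematicalPhysics.QuantumLattice
open Summit.QuantumFields.YangMills.Cruxes.OSLegsFromFemtoAndGap.DlrCollarTransfer

namespace Summit.QuantumFields.YangMills.Cruxes.NT.BoundaryLaw

/-! ## §1 Cube geometry under translations -/

/-- Translating a site and the base point together preserves cube membership. [folklore] -/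
theorem sitePlus_mem_cubeSites (c v y : Fin 4 → ℤ) (b : ℕ) : y + v ∈ cubeSites (c + v) b ↔ y ∈ cubeSites c b := by
  simp only [cubeSites, Fintype.mem_piFinset, Finset.mem_Ico, Pi.add_apply]
  constructor
  · intro h j; constructor <;> linarith [(h j).1, (h j).2]
  · intro h j; constructor <;> linarith [(h j).1, (h j).2]

/-- The interior edges of the translated cube are the translated interior edges. [folklore] -/
theorem cubeEdges_map_edgeShift (c v : Fin 4 → ℤ) (b : ℕ) :
    (cubeEdges c b).map (edgeShift v).toEmbedding = cubeEdges (c + v) b := by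
  ext e
  rw [Finset.mem_map_equiv]
  obtain ⟨y, k⟩ := e
  have hy : y = (y - v) + v := (sub_add_cancel y v).symm
  simp only [cubeEdges, Finset.mem_filter, Finset.mem_product, Finset.mem_univ, and_true, edgeShift_symm_apply]
  conv_rhs => rw [hy, add_right_comm, sitePlus_mem_cubeSites, sitePlus_mem_cubeSites]

/-- The depth function is translation invariant. [folklore] -/
theorem depth_add (c v : Fin 4 → ℤ) (b : ℕ) (y : Fin 4 → ℤ) : depth (c + v) b (y + v) = depth c b y := by
  unfold depth
  congr 1
  funext j
  simp only [Pi.add_apply]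
  congr 2 <;> ring

/-! ## §2 Observables and cube kernels under translations -/

/-- Composition of lattice translations of configurations. [folklore] -/
theorem configShift_configShift {G : Type} [MeasurableSpace G] (v w : Fin 4 → ℤ) (U : LGConfig 4 G) :
    configShift v (configShift w U) = configShift (v + w) U := by
  funext e
  simp only [Literature.MathematicalPhysics.QuantumLattice.configShift_apply, sub_sub]

section Kernel

variable (G : Type) [Group G] [TopologicalSpace G] [IsTopologicalGroup G] [CompactSpace G]
  [MeasurableSpace G] [BorelSpace G] (r : LatticeRep G)

/-- The action density at `y + v` of the configuration translated by `v` is the action density at `y`. [folklore] -/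
theorem dens_configShift (v y : Fin 4 → ℤ) (U : LGConfig 4 G) :
    dens G r (y + v) (configShift v U) = dens G r y U := by
  unfold dens
  rw [configShift_configShift, neg_add, neg_add_cancel_right]

omit [IsTopologicalGroup G] [CompactSpace G] [BorelSpace G] in
/-- The single-plane field at `y + v` of the configuration translated by `v` is the field at `y`. [folklore] -/
theorem plane_configShift (v : Fin 4 → ℤ) (q : Fin 4 × Fin 4) (y : Fin 4 → ℤ) (U : LGConfig 4 G) :
    plane G r q (y + v) (configShift v U) = plane G r q y U := by
  unfold plane
  rw [configShift_configShift, neg_add, neg_add_cancel_right]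

/-- **Translation covariance of the cube kernels**: the kernel of the translated cube with the translated exterior,
tested on `F`, is the kernel of the original cube tested on `F ∘ θ_v` (tree `ymSpecification_map_configShift` +
change of variables along the measurable automorphism `configShift v`). [folklore] -/
theorem kerE_configShift (v : Fin 4 → ℤ) (β : ℝ) (c : Fin 4 → ℤ) (b : ℕ) (η : LGConfig 4 G)
    (F : LGConfig 4 G → ℝ) :
    kerE G r β (c + v) b (configShift v η) F = kerE G r β c b η (F ∘ configShift v) := by
  haveI : SecondCountableTopology G :=
    (r.continuous.isClosedEmbedding r.injective).isEmbedding.secondCountableTopology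
  unfold kerE
  rw [← cubeEdges_map_edgeShift, ← ymSpecification_map_configShift r.ρ r.continuous β v (cubeEdges c b) η,
    integral_map_equiv]
  rfl

/-- Kernel means of the action density are translation invariant (cube, exterior and site moved together).
[folklore] -/
theorem kerE_dens_configShift (v : Fin 4 → ℤ) (β : ℝ) (c : Fin 4 → ℤ) (b : ℕ) (η : LGConfig 4 G)
    (y : Fin 4 → ℤ) :
    kerE G r β (c + v) b (configShift v η) (dens G r (y + v)) = kerE G r β c b η (dens G r y) := by
  rw [kerE_configShift]
  congr 1
  funext U
  exact dens_configShift G r v y U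

/-- Kernel means of the single-plane fields are translation invariant. [folklore] -/
theorem kerE_plane_configShift (v : Fin 4 → ℤ) (β : ℝ) (c : Fin 4 → ℤ) (b : ℕ) (η : LGConfig 4 G)
    (q : Fin 4 × Fin 4) (y : Fin 4 → ℤ) :
    kerE G r β (c + v) b (configShift v η) (plane G r q (y + v)) = kerE G r β c b η (plane G r q y) := by
  rw [kerE_configShift]
  congr 1
  funext U
  exact plane_configShift G r v q y U

/-! ## §3 Pointwise transports: from cubes at the origin to all cubes -/

/-- **Boundary-law inequalities for the action density transport from origin-based cubes to all cubes** (at any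
fixed `β`, side `b`, depth threshold `D`, reference value `p`, constant `C₁`). [folklore] -/
theorem boundaryLaw_dens_of_origin (β : ℝ) (b : ℕ) (D : ℕ) (p C₁ : ℝ)
    (h : ∀ (η : LGConfig 4 G) (y : Fin 4 → ℤ), D ≤ depth 0 b y →
      |kerE G r β 0 b η (dens G r y) - p| ≤ C₁ / (depth 0 b y : ℝ) ^ 4)
    (c : Fin 4 → ℤ) (η : LGConfig 4 G) (x : Fin 4 → ℤ) (hx : D ≤ depth c b x) :
    |kerE G r β c b η (dens G r x) - p| ≤ C₁ / (depth c b x : ℝ) ^ 4 := by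
  have hc : (0 : Fin 4 → ℤ) + c = c := zero_add c
  have hxx : (x - c) + c = x := sub_add_cancel x c
  have hη : configShift c (configShift (-c) η) = η := by
    rw [configShift_configShift, add_neg_cancel]
    funext e; simp
  have hker : kerE G r β c b η (dens G r x) = kerE G r β 0 b (configShift (-c) η) (dens G r (x - c)) := by
    conv_lhs => rw [← hc, ← hη, ← hxx]
    exact kerE_dens_configShift G r c β 0 b _ (x - c)
  have hdepth : depth c b x = depth 0 b (x - c) := by
    conv_lhs => rw [← hc, ← hxx]
    exact depth_add 0 c b (x - c)
  rw [hker, hdepth]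
  exact h _ _ (hdepth ▸ hx)

/-- **Boundary-law inequalities for the `(0,1)`-plaquette field transport from origin-based cubes to all cubes and
all orientations** (translation covariance, then the coordinate permutation with `σ 0 = i`, `σ 1 = j` of
`…Symmetry`). [folklore] -/
theorem boundaryLaw_plane_of_origin01 (β : ℝ) (b : ℕ) (D : ℕ) (p C₁ : ℝ)
    (h : ∀ (η : LGConfig 4 G) (y : Fin 4 → ℤ), D ≤ depth 0 b y →
      |kerE G r β 0 b η (plane G r (0, 1) y) - p| ≤ C₁ / (depth 0 b y : ℝ) ^ 4)
    (c : Fin 4 → ℤ) (η : LGConfig 4 G) (q : Fin 4 × Fin 4) (hq : q.1 < q.2) (x : Fin 4 → ℤ)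
    (hx : D ≤ depth c b x) :
    |kerE G r β c b η (plane G r q x) - p| ≤ C₁ / (depth c b x : ℝ) ^ 4 := by
  -- step 1: all cubes, orientation (0,1)
  have h01 : ∀ (c' : Fin 4 → ℤ) (η' : LGConfig 4 G) (x' : Fin 4 → ℤ), D ≤ depth c' b x' →
      |kerE G r β c' b η' (plane G r (0, 1) x') - p| ≤ C₁ / (depth c' b x' : ℝ) ^ 4 := by
    intro c' η' x' hx'
    have hc : (0 : Fin 4 → ℤ) + c' = c' := zero_add c'
    have hxx : (x' - c') + c' = x' := sub_add_cancel x' c'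
    have hη : configShift c' (configShift (-c') η') = η' := by
      rw [configShift_configShift, add_neg_cancel]
      funext e; simp
    have hker : kerE G r β c' b η' (plane G r (0, 1) x') =
        kerE G r β 0 b (configShift (-c') η') (plane G r (0, 1) (x' - c')) := by
      conv_lhs => rw [← hc, ← hη, ← hxx]
      exact kerE_plane_configShift G r c' β 0 b _ (0, 1) (x' - c')
    have hdepth : depth c' b x' = depth 0 b (x' - c') := by
      conv_lhs => rw [← hc, ← hxx]
      exact depth_add 0 c' b (x' - c')
    rw [hker, hdepth]
    exact h _ _ (hdepth ▸ hx')
  -- step 2: all orientations, by a coordinate permutation with `σ 0 = q.1`, `σ 1 = q.2`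
  obtain ⟨σ, h0, h1⟩ : ∃ σ : Equiv.Perm (Fin 4), σ 0 = q.1 ∧ σ 1 = q.2 := by
    have hne : q.1 ≠ q.2 := ne_of_lt hq
    have hk : Equiv.swap (0 : Fin 4) q.1 1 ≠ q.1 := by
      intro hk
      have h01' : (Equiv.swap (0 : Fin 4) q.1) 1 = Equiv.swap (0 : Fin 4) q.1 0 := by
        rw [hk, Equiv.swap_apply_left]
      exact absurd ((Equiv.swap (0 : Fin 4) q.1).injective h01') one_ne_zero
    refine ⟨(Equiv.swap 0 q.1).trans (Equiv.swap (Equiv.swap 0 q.1 1) q.2), ?_, ?_⟩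
    · rw [Equiv.trans_apply, Equiv.swap_apply_left, Equiv.swap_apply_of_ne_of_ne hk.symm hne]
    · rw [Equiv.trans_apply, Equiv.swap_apply_left]
  set c₀ : Fin 4 → ℤ := sitePerm σ.symm c with hc₀
  set x₀ : Fin 4 → ℤ := sitePerm σ.symm x with hx₀
  set η₀ : LGConfig 4 G := (relabelConfig (edgePerm σ)).symm η with hη₀
  have hc : sitePerm σ c₀ = c := by
    rw [hc₀, ← sitePerm_symm]; exact (sitePerm σ).apply_symm_apply c
  have hxx : sitePerm σ x₀ = x := by
    rw [hx₀, ← sitePerm_symm]; exact (sitePerm σ).apply_symm_apply x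
  have hη : relabelConfig (edgePerm σ) η₀ = η := (relabelConfig (edgePerm σ)).apply_symm_apply η
  have hq' : q = (σ (0, (1 : Fin 4)).1, σ (0, (1 : Fin 4)).2) := by rw [h0, h1]
  have hker : kerE G r β c b η (plane G r q x) = kerE G r β c₀ b η₀ (plane G r (0, 1) x₀) := by
    rw [← hc, ← hxx, ← hη, hq']
    exact kerE_plane_perm G r σ β c₀ b η₀ (0, 1) x₀
  have hdepth : depth c b x = depth c₀ b x₀ := by
    rw [← hc, ← hxx, depth_sitePerm]
  rw [hker, hdepth]
  exact h01 c₀ η₀ x₀ (hdepth ▸ hx)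

/-! ## §4 The cores -/

/-- **Core form of `FBL`.**  The registered boundary law for the action density follows from a boundary law on
origin-based femto cubes at depths `≥ D` only (any `D`, any reference values `p`, any sign of `C₁`). [folklore] -/
theorem fbl_of_core (a : ℝ → ℝ) (D : ℕ)
    (h : ∃ (C₁ β₁ ℓ₁ : ℝ) (p : ℝ → ℝ), 0 < ℓ₁ ∧ ∀ β : ℝ, β₁ ≤ β → ∀ b : ℕ, (b : ℝ) * a β ≤ ℓ₁ →
      ∀ (η : LGConfig 4 G) (y : Fin 4 → ℤ), D ≤ depth 0 b y →
        |kerE G r β 0 b η (dens G r y) - p β| ≤ C₁ / (depth 0 b y : ℝ) ^ 4) :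
    FBL G r a := by
  obtain ⟨C₁, β₁, ℓ₁, p, hℓ₁, H⟩ := h
  exact fbl_of_largeDepth G r a D ⟨C₁, β₁, ℓ₁, p, hℓ₁, fun β hβ c b hb η x hx =>
    boundaryLaw_dens_of_origin G r β b D (p β) C₁ (H β hβ b hb) c η x hx⟩

/-- **Core form of `FBL6`.**  The registered plane-resolved boundary law follows from a boundary law for the ONE
`(0,1)`-plaquette field on origin-based femto cubes at depths `≥ D` only. [folklore] -/
theorem fbl6_of_core (a : ℝ → ℝ) (D : ℕ)
    (h : ∃ (C₁ β₁ ℓ₁ : ℝ) (p : ℝ → ℝ), 0 < ℓ₁ ∧ ∀ β : ℝ, β₁ ≤ β → ∀ b : ℕ, (b : ℝ) * a β ≤ ℓ₁ →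
      ∀ (η : LGConfig 4 G) (y : Fin 4 → ℤ), D ≤ depth 0 b y →
        |kerE G r β 0 b η (plane G r (0, 1) y) - p β| ≤ C₁ / (depth 0 b y : ℝ) ^ 4) :
    FBL6 G r a := by
  obtain ⟨C₁, β₁, ℓ₁, p, hℓ₁, H⟩ := h
  exact fbl6_of_largeDepth G r a D ⟨C₁, β₁, ℓ₁, fun _ β => p β, hℓ₁, fun β hβ c b hb η q x hq hx =>
    boundaryLaw_plane_of_origin01 G r β b D (p β) C₁ (H β hβ b hb) c η q hq x hx⟩

end Kernel

end Summit.QuantumFields.YangMills.Cruxes.NT.BoundaryLaw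

end
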